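import Summits.CriticalPhenomena.SAWScalingLimit.Theorems.SAWDefectDecoherenceBoundaryClosureRDevelopingMapsCompactCore
import HarnessLib

/-!
# The root wedge: chaining the local link of the developing maps (crux `BoundaryClosureR`,
stmt-CriticalPhenomena-14004, line `pick-half-plane`, stub `stub_rootWedgeOfNoMax`)

Support file (topic: two-sided bounds `δ‖H s − H s_b‖ ≤ B‖F(b δ)‖` for the developing map
`H` (a potential of `F dz`) at sites `s` near a point of the carrier, obtained by CHAINING the
landed one-scale local link `DevelopingMaps.core_link` along finitely many overlapping balls).

* lattice geometry of one cell (`cell_geometry`), a site within `2δ` of any point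
  (`exists_site_near`);
* `chain_step`: if the bound holds at the sites within `η` of `p`, the closed ball
  `closedBall p (39η)` lies in a compact `K'` exhausted by `Λ δ` on which the local sup law holds
  with constant `C`, and `dist q p ≤ η/2`, then the bound holds at the sites within `η` of `q` with
  constant `B + 24 C η`;
Pure bookkeeping around Duminil-Copin–Smirnov 2012, §4 (the map `H` with `dH = F dz`).
-/

noncomputable section

open scoped Topology
open Filter Set
open Literature.Probability.LatticeModels Literature.Probability.RandomPlanarGeometry
open Literature.Probability.RandomPlanarGeometry.SAW
open Summit.CriticalPhenomena.SAWScalingLimit.Theorems.PickHalfPlane.DevelopingMaps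

namespace Summit.CriticalPhenomena.SAWScalingLimit.Theorems.PickHalfPlane.RootWedge

/-! ### Lattice geometry of one cell -/

/-- Scaling a difference by a real `δ ≥ 0` scales its norm. [folklore] -/
theorem norm_smul_sub {δ : ℝ} (hδ : 0 ≤ δ) (u v : ℂ) :
    ‖(δ : ℂ) * u - (δ : ℂ) * v‖ = δ * ‖u - v‖ := by
  rw [← mul_sub, norm_mul, Complex.norm_real, Real.norm_of_nonneg hδ]

/-- **One cell of the lattice pair.**  For the cell `(k, l)`: the centre of `upFace k l`, the
midpoint of the up-edge `{upFace k l, (![k-1,l],1)}` and the midpoint of `floorEdge k l` are within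
distance `1` of the site `![k, l]`, at heights `(l + 1/3)√3/2`, `(l + 1/2)√3/2`, `l√3/2`. [folklore] -/
theorem cell_geometry (k l : ℤ) :
    ‖hexCenter (upFace k l) - triEmbed ![k, l]‖ ≤ 1 ∧
    (hexCenter (upFace k l)).im = (l : ℝ) * (Real.sqrt 3 / 2) + Real.sqrt 3 / 6 ∧
    ‖hexMidpoint s(upFace k l, ((![k - 1, l], 1) : HexVertex)) - triEmbed ![k, l]‖ ≤ 1 ∧
    (hexMidpoint s(upFace k l, ((![k - 1, l], 1) : HexVertex))).im =
      (l : ℝ) * (Real.sqrt 3 / 2) + Real.sqrt 3 / 4 ∧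
    ‖hexMidpoint (floorEdge k l) - triEmbed ![k, l]‖ ≤ 1 ∧
    (hexMidpoint (floorEdge k l)).im = (l : ℝ) * (Real.sqrt 3 / 2) := by
  have hz := norm_triZeta
  have hc : hexCenter (upFace k l) = triEmbed ![k, l] + (1 + triZeta) / 3 := by
    unfold upFace; simp [hexCenter]
  refine ⟨?_, ?_, ?_, ?_, ?_, ?_⟩
  · rw [hc, add_sub_cancel_left, norm_div]
    have h3 : ‖(3 : ℂ)‖ = 3 := by simp
    rw [h3]
    calc ‖(1 : ℂ) + triZeta‖ / 3 ≤ (‖(1 : ℂ)‖ + ‖triZeta‖) / 3 := by gcongr; exact norm_add_le _ _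
      _ ≤ 1 := by rw [norm_one, hz]; norm_num
  · rw [hc, Complex.add_im, im_triEmbed_vec2]
    simp [Complex.div_ofNat_im, triZeta_im]; ring
  · rw [hexMidpoint_upEdge, add_sub_cancel_left, norm_div, hz]; norm_num
  · rw [hexMidpoint_upEdge, Complex.add_im, im_triEmbed_vec2]
    simp [Complex.div_ofNat_im, triZeta_im]; ring
  · rw [hexMidpoint_floorEdge, add_sub_cancel_left]; norm_num
  · rw [hexMidpoint_floorEdge, Complex.add_im, im_triEmbed_vec2]; simp

/-- A point within `1` of a site (lattice units) scales to a point within `A + δ` of any `z` with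
`‖δ·site − z‖ ≤ A`. [folklore] -/
theorem norm_scaled_sub_le {δ A : ℝ} (hδ : 0 ≤ δ) {u t z : ℂ} (hu : ‖u - t‖ ≤ 1)
    (ht : ‖(δ : ℂ) * t - z‖ ≤ A) : ‖(δ : ℂ) * u - z‖ ≤ A + δ := by
  have h1 : ‖(δ : ℂ) * u - (δ : ℂ) * t‖ ≤ δ := by
    rw [norm_smul_sub hδ]; exact (mul_le_mul_of_nonneg_left hu hδ).trans (le_of_eq (mul_one δ))
  calc ‖(δ : ℂ) * u - z‖ = ‖((δ : ℂ) * u - (δ : ℂ) * t) + ((δ : ℂ) * t - z)‖ := by ring_nf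
    _ ≤ ‖(δ : ℂ) * u - (δ : ℂ) * t‖ + ‖(δ : ℂ) * t - z‖ := norm_add_le _ _
    _ ≤ A + δ := by linarith

/-- Imaginary part of a scaled point. [folklore] -/
theorem im_real_mul (δ : ℝ) (u : ℂ) : ((δ : ℂ) * u).im = δ * u.im := by simp

/-- Real part of a scaled point. [folklore] -/
theorem re_real_mul (δ : ℝ) (u : ℂ) : ((δ : ℂ) * u).re = δ * u.re := by simp

/-- **A site within `2δ` of any point.**  For `δ > 0` and `w ∈ ℂ` some site `s` of the triangular
lattice has `‖δ·s − w‖ ≤ 2δ` (row `⌊im w/(δ√3/2)⌋`, then the column by rounding down). [folklore] -/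
theorem exists_site_near {δ : ℝ} (hδ : 0 < δ) (w : ℂ) :
    ∃ s : Site 2, ‖(δ : ℂ) * triEmbed s - w‖ ≤ 2 * δ := by
  set c : ℝ := Real.sqrt 3 / 2 with hcdef
  have hc0 : 0 < c := by positivity
  have hc1 : c ≤ 1 := by
    rw [hcdef, div_le_one (by norm_num : (0 : ℝ) < 2)]
    have h3 : Real.sqrt 3 ≤ Real.sqrt 4 := Real.sqrt_le_sqrt (by norm_num)
    have h4 : Real.sqrt 4 = 2 := by
      rw [show (4 : ℝ) = 2 ^ 2 by norm_num, Real.sqrt_sq (by norm_num : (0 : ℝ) ≤ 2)]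
    linarith
  set l : ℤ := ⌊w.im / (δ * c)⌋ with hl
  set k : ℤ := ⌊w.re / δ - l / 2⌋ with hk
  refine ⟨![k, l], ?_⟩
  have hre : ((δ : ℂ) * triEmbed ![k, l] - w).re = δ * (k + l / 2) - w.re := by
    rw [Complex.sub_re, re_real_mul, re_triEmbed_vec2]; ring
  have him : ((δ : ℂ) * triEmbed ![k, l] - w).im = δ * c * l - w.im := by
    rw [Complex.sub_im, im_real_mul, im_triEmbed_vec2]; ring
  have hδc : 0 < δ * c := mul_pos hδ hc0
  have hl1 : (l : ℝ) ≤ w.im / (δ * c) := Int.floor_le _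
  have hl2 : w.im / (δ * c) < l + 1 := Int.lt_floor_add_one _
  have hk1 : (k : ℝ) ≤ w.re / δ - l / 2 := Int.floor_le _
  have hk2 : w.re / δ - l / 2 < k + 1 := Int.lt_floor_add_one _
  have h1 : |δ * (k + l / 2) - w.re| ≤ δ := by
    rw [abs_le]
    have e1 := mul_le_mul_of_nonneg_left hk1 hδ.le
    have e2 := mul_lt_mul_of_pos_left hk2 hδ
    rw [mul_sub, mul_div_cancel₀ _ hδ.ne'] at e1 e2
    constructor <;> nlinarith
  have h2 : |δ * c * l - w.im| ≤ δ := by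
    rw [abs_le]
    have e1 := mul_le_mul_of_nonneg_left hl1 hδc.le
    have e2 := mul_lt_mul_of_pos_left hl2 hδc
    rw [mul_div_cancel₀ _ hδc.ne'] at e1 e2
    have : δ * c ≤ δ := by nlinarith
    constructor <;> nlinarith
  calc ‖(δ : ℂ) * triEmbed ![k, l] - w‖
      ≤ |((δ : ℂ) * triEmbed ![k, l] - w).re| + |((δ : ℂ) * triEmbed ![k, l] - w).im| :=
        Complex.norm_le_abs_re_add_abs_im _
    _ ≤ δ + δ := by rw [hre, him]; exact add_le_add h1 h2
    _ = 2 * δ := by ring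

/-- The up-edge over a cell of `Λ` is a mid-edge of `Ω`. [folklore] -/
theorem upEdge_mem_midEdges {Λ : Finset HexVertex} {k l : ℤ} (h : upFace k l ∈ Λ) :
    s(upFace k l, ((![k - 1, l], 1) : HexVertex)) ∈ hexDomainMidEdges Λ :=
  ⟨(SimpleGraph.mem_edgeSet hexGraph).2 (adj_upFace_west k l), upFace k l, Sym2.mem_mk_left _ _, h⟩

/-- The floor edge under a cell of `Λ` is a mid-edge of `Ω`. [folklore] -/
theorem floorEdge_mem_midEdges {Λ : Finset HexVertex} {k l : ℤ} (h : upFace k l ∈ Λ) :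
    floorEdge k l ∈ hexDomainMidEdges Λ :=
  ⟨(SimpleGraph.mem_edgeSet hexGraph).2 (adj_belowFace_upFace k l), upFace k l,
    Sym2.mem_mk_right _ _, h⟩

/-- Un-dividing the normalised increment: `‖δ·v / F‖ ≤ X` and `F ≠ 0` give `δ‖v‖ ≤ X‖F‖`.
[folklore] -/
theorem mul_norm_le_of_norm_div_le {δ X : ℝ} (hδ : 0 ≤ δ) {v F : ℂ} (hF : F ≠ 0)
    (h : ‖(δ : ℂ) * v / F‖ ≤ X) : δ * ‖v‖ ≤ X * ‖F‖ := by
  have hFpos : 0 < ‖F‖ := norm_pos_iff.2 hF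
  rw [norm_div, div_le_iff₀ hFpos, norm_mul, Complex.norm_real, Real.norm_of_nonneg hδ] at h
  exact h

/-! ### One step of the chain -/

/-- **Chain step.**  Suppose that eventually, for every potential `H` of the root-`e δ` observable
and every normaliser site `s_b`, `δ‖H s − H s_b‖ ≤ B‖F(b δ)‖` at all sites `s` with
`‖δ s − p‖ ≤ η`.  If `closedBall p (39η)` lies in a set `K'` which is eventually exhausted by
`Λ δ` and on whose mid-edges the observable is eventually bounded by `C‖F(b δ)‖`, `F(b δ) ≠ 0`
eventually, and `dist q p ≤ η/2`, then the same holds at all sites within `η` of `q` with the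
constant `B + 24 C η` (one local link `core_link` of radius `2η` about `p`).
[cite: DuminilCopinSmirnov2012, §4 (the map H with dH = F dz)] -/
theorem chain_step {Λ : ℝ → Finset HexVertex} {e b : ℝ → Sym2 HexVertex} {K' : Set ℂ} {p q : ℂ}
    {η C B : ℝ} (hη : 0 < η) (hC : 0 ≤ C) (hpq : dist q p ≤ η / 2)
    (hK : Metric.closedBall p (39 * η) ⊆ K')
    (hexh : ∀ᶠ δ : ℝ in 𝓝[>] 0, ∀ v : HexVertex, (δ : ℂ) * hexCenter v ∈ K' → v ∈ Λ δ)
    (hCK : ∀ᶠ δ : ℝ in 𝓝[>] 0, ∀ w ∈ hexDomainMidEdges (Λ δ), (δ : ℂ) * hexMidpoint w ∈ K' →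
      ‖hexParafermionicObservable (Λ δ) (e δ) hexCriticalFugacity (5 / 8) w‖ ≤
        C * ‖hexParafermionicObservable (Λ δ) (e δ) hexCriticalFugacity (5 / 8) (b δ)‖)
    (hFb : ∀ᶠ δ : ℝ in 𝓝[>] 0,
      hexParafermionicObservable (Λ δ) (e δ) hexCriticalFugacity (5 / 8) (b δ) ≠ 0)
    (hQ : ∀ᶠ δ : ℝ in 𝓝[>] 0, ∀ H : Site 2 → ℂ, IsPotential (Λ δ) (e δ) H →
      ∀ ub wb : HexVertex, b δ = s(ub, wb) →
      ∀ sb : Site 2, sb ∈ hexFaceVertices ub → sb ∈ hexFaceVertices wb →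
      ∀ s : Site 2, ‖(δ : ℂ) * triEmbed s - p‖ ≤ η →
        δ * ‖H s - H sb‖ ≤ B * ‖hexParafermionicObservable (Λ δ) (e δ) hexCriticalFugacity (5 / 8) (b δ)‖) :
    ∀ᶠ δ : ℝ in 𝓝[>] 0, ∀ H : Site 2 → ℂ, IsPotential (Λ δ) (e δ) H →
      ∀ ub wb : HexVertex, b δ = s(ub, wb) →
      ∀ sb : Site 2, sb ∈ hexFaceVertices ub → sb ∈ hexFaceVertices wb →
      ∀ s : Site 2, ‖(δ : ℂ) * triEmbed s - q‖ ≤ η →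
        δ * ‖H s - H sb‖ ≤
          (B + 24 * C * η) * ‖hexParafermionicObservable (Λ δ) (e δ) hexCriticalFugacity (5 / 8) (b δ)‖ := by
  have hδev : ∀ᶠ δ : ℝ in 𝓝[>] 0, δ ∈ Set.Ioo 0 (η / 2) := Ioo_mem_nhdsGT (half_pos hη)
  filter_upwards [hexh, hCK, hFb, hQ, hδev] with δ hexhδ hCδ hFbδ hQδ ⟨hδ0, hδη⟩ H hH ub wb hb sb
    hsbu hsbw s hs
  set Fb := hexParafermionicObservable (Λ δ) (e δ) hexCriticalFugacity (5 / 8) (b δ)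
  obtain ⟨s', hs'⟩ := exists_site_near hδ0 p
  have hs'η : ‖(δ : ℂ) * triEmbed s' - p‖ ≤ η := by linarith
  have hsp : ‖(δ : ℂ) * triEmbed s - p‖ ≤ 2 * η := by
    calc ‖(δ : ℂ) * triEmbed s - p‖ = ‖((δ : ℂ) * triEmbed s - q) + (q - p)‖ := by ring_nf
      _ ≤ ‖(δ : ℂ) * triEmbed s - q‖ + ‖q - p‖ := norm_add_le _ _
      _ ≤ η + η / 2 := add_le_add hs (by rwa [← dist_eq_norm])
      _ ≤ 2 * η := by linarith
  -- every scaled object of a cell within `38 η` of `p` lies in `K'`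
  have hnear : ∀ (k l : ℤ) (u : ℂ), ‖u - triEmbed ![k, l]‖ ≤ 1 →
      ‖(δ : ℂ) * triEmbed ![k, l] - p‖ ≤ 19 * (2 * η) → (δ : ℂ) * u ∈ K' := by
    intro k l u hu hkl
    refine hK (Metric.mem_closedBall.2 ?_)
    rw [dist_eq_norm]
    have := norm_scaled_sub_le hδ0.le hu hkl
    linarith
  have hface : ∀ k l : ℤ, ‖(δ : ℂ) * triEmbed ![k, l] - p‖ ≤ 19 * (2 * η) → upFace k l ∈ Λ δ :=
    fun k l hkl => hexhδ _ (hnear k l _ (cell_geometry k l).1 hkl)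
  have key := core_link (Λ := Λ δ) (a := e δ) (b₀ := b δ) (s := s') (s' := s) (z := p)
    (C := C) hδ0 (by linarith) hC (by linarith) hsp
    (fun k l _ hkl => hface k l hkl)
    (fun k l _ hkl => hCδ _ (upEdge_mem_midEdges (hface k l hkl))
      (hnear k l _ (cell_geometry k l).2.2.1 hkl))
    (fun k l _ hkl => hCδ _ (floorEdge_mem_midEdges (hface k l hkl))
      (hnear k l _ (cell_geometry k l).2.2.2.2.1 hkl))
  have hlink := key.2 H hH
  have hdist : ‖(δ : ℂ) * triEmbed s - (δ : ℂ) * triEmbed s'‖ ≤ 3 * η := by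
    calc ‖(δ : ℂ) * triEmbed s - (δ : ℂ) * triEmbed s'‖
        = ‖((δ : ℂ) * triEmbed s - p) - ((δ : ℂ) * triEmbed s' - p)‖ := by ring_nf
      _ ≤ ‖(δ : ℂ) * triEmbed s - p‖ + ‖(δ : ℂ) * triEmbed s' - p‖ := norm_sub_le _ _
      _ ≤ 3 * η := by linarith
  have h1 : δ * ‖H s - H s'‖ ≤ 24 * C * η * ‖Fb‖ := by
    have h := mul_norm_le_of_norm_div_le hδ0.le hFbδ hlink
    refine h.trans (mul_le_mul_of_nonneg_right ?_ (norm_nonneg _))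
    nlinarith [mul_nonneg (mul_nonneg (by norm_num : (0 : ℝ) ≤ 6) hC) (show 0 ≤ η by linarith)]
  have h2 : δ * ‖H s' - H sb‖ ≤ B * ‖Fb‖ := hQδ H hH ub wb hb sb hsbu hsbw s' hs'η
  calc δ * ‖H s - H sb‖ = δ * ‖(H s - H s') + (H s' - H sb)‖ := by ring_nf
    _ ≤ δ * (‖H s - H s'‖ + ‖H s' - H sb‖) := mul_le_mul_of_nonneg_left (norm_add_le _ _) hδ0.le
    _ ≤ 24 * C * η * ‖Fb‖ + B * ‖Fb‖ := by rw [mul_add]; exact add_le_add h1 h2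
    _ = (B + 24 * C * η) * ‖Fb‖ := by ring

/-- **Registered piece `rootWedge_chainStep`** of stub `stub_rootWedgeOfNoMax` (crux
stmt-CriticalPhenomena-14004, line `pick-half-plane`): the chain step in registry form (one
`∀`-term; see `chain_step`). [cite: DuminilCopinSmirnov2012, §4 (the map H with dH = F dz)] -/
theorem rootWedge_chainStep : ∀ (Λ : ℝ → Finset HexVertex) (e b : ℝ → Sym2 HexVertex) (K' : Set ℂ) (p q : ℂ) (η C B : ℝ), 0 < η → 0 ≤ C → dist q p ≤ η / 2 → Metric.closedBall p (39 * η) ⊆ K' → (∀ᶠ δ : ℝ in 𝓝[>] 0, ∀ v : HexVertex, (δ : ℂ) * hexCenter v ∈ K' → v ∈ Λ δ) → (∀ᶠ δ : ℝ in 𝓝[>] 0, ∀ w ∈ hexDomainMidEdges (Λ δ), (δ : ℂ) * hexMidpoint w ∈ K' → ‖hexParafermionicObservable (Λ δ) (e δ) hexCriticalFugacity (5 / 8) w‖ ≤ C * ‖hexParafermionicObservable (Λ δ) (e δ) hexCriticalFugacity (5 / 8) (b δ)‖) → (∀ᶠ δ : ℝ in 𝓝[>] 0, hexParafermionicObservable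 (Λ δ) (e δ) hexCriticalFugacity (5 / 8) (b δ) ≠ 0) → (∀ᶠ δ : ℝ in 𝓝[>] 0, ∀ H : Site 2 → ℂ, IsPotential (Λ δ) (e δ) H → ∀ ub wb : HexVertex, b δ = s(ub, wb) → ∀ sb : Site 2, sb ∈ hexFaceVertices ub → sb ∈ hexFaceVertices wb → ∀ s : Site 2, ‖(δ : ℂ) * triEmbed s - p‖ ≤ η → δ * ‖H s - H sb‖ ≤ B * ‖hexParafermionicObservable (Λ δ) (e δ) hexCriticalFugacity (5 / 8) (b δ)‖) → ∀ᶠ δ : ℝ in 𝓝[>] 0, ∀ H : Site 2 → ℂ, IsPotential (Λ δ) (e δ) H → ∀ ub wb : HexVertex, b δ = s(ub, wb) → ∀ sb : Site 2, sb ∈ hexFaceVertices ub → sb ∈ hexFaceVertices wb → ∀ s : Site 2, ‖(δ : ℂ) * triEmbed s - q‖ ≤ η → δ * ‖H s - H sb‖ ≤ (B + 24 * C * η) * ‖hexParafermionicObservable (Λ δ) (e δ) hexCriticalFugacity (5 / 8) (b δ)‖ :=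
  fun _ _ _ _ _ _ _ _ _ hη hC hpq hK hexh hCK hFb hQ => chain_step hη hC hpq hK hexh hCK hFb hQ

end Summit.CriticalPhenomena.SAWScalingLimit.Theorems.PickHalfPlane.RootWedge

end
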